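import Mathlib
import Summits.KontsevichZagierPeriods.Zeta5Search.FourthOrderPair
import Summits.KontsevichZagierPeriods.Zeta5Search.ThirdOrderAggregate
import Summits.KontsevichZagierPeriods.Zeta5Search.ZeroWindowKit
import Summits.KontsevichZagierPeriods.Zeta5Search.FourthOrderResidue
import HarnessLib

/-!
# ζ(5) search — THEOREM L5, aggregation: `2·(W/(−p)^{3−M}, V/(−p)^{−M}) ≡ A·t₁ (mod p⁴)` once the residue sum vanishes

Cell `pub-zeta5` (HONEST FRAMING: systematic search; no irrationality claim unless certified), typer seat generation 13.
REPORT-gen2-g14 §2 (Proposition) + §4: under the class clauses `LawA4Classes ∧ ShapeClause` of a frame `(M, T)` (`M ≥ 10` even, `T`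
palindromic), every residue `x < p` together with its conjugate contributes `A_x·t₁ + C_x·t₃ + O(p⁴)` to the conjugation-symmetrised
aggregate (`pair₅` for live classes, `negl₄` for the rest), with `Σ_x C_x ≡ −2p³·Σ_{x live} ĝ_x κ_{3−i}(x) (mod p⁴)`; so if the LIVE
RESIDUE SUM `Σ_{x live} ĝ_x κ_{3−i}(x)` is `≡ 0 (mod p)` (hypothesis `hres` — the second residue law over `𝔽_p`, REPORT §3, supplied by
gen-2 g15's `liveKappaSum_small`), then **`2·W/(−p)^{3−M} ≡ A·t₁,W`, `2·V/(−p)^{−M} ≡ A·t₁,V (mod p⁴)`, `‖A‖ ≤ p⁻¹`** (`aggregate₅`).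
Given the classwise digits `FourthDigitW/V` by name.  `p`-adic norms of rationals; nothing here bears on irrationality.
-/

noncomputable section

open Finset PowerSeries

namespace Summit.KontsevichZagierPeriods.Zeta5Search.SecondOrder

open Summit.KontsevichZagierPeriods.Zeta5Search.CasoratianValuation (InPolytope)
open Summit.KontsevichZagierPeriods.Zeta5Search.ClusterValuation
open Summit.KontsevichZagierPeriods.Zeta5Search.WedgeDictionary (coeffW coeffV)
open Summit.KontsevichZagierPeriods.Zeta5Search.PadicSeries
open Summit.KontsevichZagierPeriods.Zeta5Search.CellA (classW coeffW_eq_sum_classW padicNorm_p)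
open Summit.KontsevichZagierPeriods.Zeta5Search.LevelClass (typeExp typeW level_mem)
open Summit.KontsevichZagierPeriods.Zeta5Search.BigPrime (padicNorm_mul_le_one)
open Summit.KontsevichZagierPeriods.Zeta5Search.RecordWindowsA4 (LawA4Classes)
open Summit.KontsevichZagierPeriods.Zeta5Search.SecondResidueLaw (phi3Hat cubicHat lambdaP isRaiseN ShapeClause FourthDigitW FourthDigitV)

variable {p : ℕ} [hp : Fact p.Prime]

/-! ## §1 The live residue summand and small facts -/

/-- The summand of the live residue sum: `ĝ_x κ_{3−i}(x)`, `i = E_x + M` (as in gen-2 g15's `liveKappaSum_small`). -/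
def liveKappa (b : ℕ → ℤ) (p M x : ℕ) : ℚ :=
  gHat b p x * (if classExp b p x + M = 0 then cubicHat b p x else if classExp b p x + M = 1 then curvHat b p x
    else if classExp b p x + M = 2 then phiHat b p x else 1)

/-- The live set: multipole classes of exponent `≤ −M + 3`. -/
def liveSet (b : ℕ → ℤ) (p M : ℕ) : Finset ℕ :=
  (range p).filter fun x => 2 ≤ classPoleCount b p x ∧ classExp b p x ≤ -(M : ℤ) + 3

omit hp in
/-- `κ_{3−i}` in the two spellings. -/
theorem kappaQ_three_sub (b : ℕ → ℤ) (p x M i : ℕ) (hi : classExp b p x + M = i) (hi3 : i ≤ 3) :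
    gHat b p x * kappaQ b p x (3 - i) = liveKappa b p M x := by
  unfold kappaQ liveKappa
  rw [hi]
  rcases (show i = 0 ∨ i = 1 ∨ i = 2 ∨ i = 3 by omega) with rfl | rfl | rfl | rfl <;> simp

section Agg

variable (b : ℕ → ℤ) (hb : InPolytope b) (hp5 : 5 ≤ p) (hpn : (p : ℤ) ≤ b 0) (hwin : (b 0 + 2 : ℤ) < (p : ℤ) ^ 2)
  {M : ℕ} (hM : 10 ≤ M) (hMe : Even M) {T : List ℤ} (hT : T.reverse = T)
  (hC : LawA4Classes b p M T) (hS : ShapeClause b p M T) (hW4 : FourthDigitW) (hV4 : FourthDigitV)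
include hb hp5 hpn hwin hM hMe hT hC hS hW4 hV4

omit hpn hMe hT hS hW4 hV4 in
/-- **Negligible classes**: a residue outside the live set has `‖Ω_y‖, ‖N_y‖ ≤ p⁻⁴`. -/
theorem negl₄ {y : ℕ} (hy : y < p) (hny : ¬ (2 ≤ classPoleCount b p y ∧ classExp b p y ≤ -(M : ℤ) + 3)) :
    padicNorm p (classW b p y / (-(p : ℚ)) ^ (-(M : ℤ) + 3)) ≤ (p : ℚ) ^ (-(4 : ℤ)) ∧
      padicNorm p (classV b p y / (-(p : ℚ)) ^ (-(M : ℤ))) ≤ (p : ℚ) ^ (-(4 : ℤ)) := by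
  obtain ⟨c1, c2, -, -, -⟩ := hC
  have hmult : 2 ≤ classPoleCount b p y → -(M : ℤ) + 4 ≤ classExp b p y := fun h2 => by
    by_contra h; exact hny ⟨h2, by omega⟩
  refine ⟨norm_div_neg_p_zpow (by
      have h := CellD.padicNorm_classW_le b hb hp5 hwin (m := -(M : ℤ) + 4) (by omega) hmult
      rwa [show -(M : ℤ) + 3 + 4 = -(M : ℤ) + 4 + 3 by ring]),
    norm_div_neg_p_zpow (CellD.padicNorm_classV_le_of b hb hp5 hwin hy (v := -(M : ℤ) + 4) fun h1 => ?_)⟩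
  by_cases h2 : 2 ≤ classPoleCount b p y
  · exact (hmult h2).trans (CellA.classExp_le_classNu b p y)
  · have hone : classPoleCount b p y = 1 := by omega
    have hE6 := ResidueFour.neg_six_le_classExp_of_classPoleCount_le_one b p y (by omega)
    by_cases hνE : classNu b p y = classExp b p y
    · rw [hνE]; omega
    · have := (tame_of_classNu_ne b hνE).2; omega

/-- **AGGREGATION (THEOREM L5 for one parameter vector).**  If the live residue sum is `≡ 0 (mod p)`, then
`2·W/(−p)^{3−M} ≡ A·t₁,W`, `2·V/(−p)^{−M} ≡ A·t₁,V (mod p⁴)` with ONE scalar `A`, `‖A‖ ≤ p⁻¹`. -/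
theorem aggregate₅ (hTM : typeExp (tTop T) (tList T) = -(M : ℤ))
    (hres : padicNorm p (∑ x ∈ liveSet b p M, liveKappa b p M x) ≤ (p : ℚ) ^ (-(1 : ℤ))) :
    ∃ A : ℚ, padicNorm p A ≤ (p : ℚ) ^ (-(1 : ℤ)) ∧
      padicNorm p (2 * (coeffW b / (-(p : ℚ)) ^ (-(M : ℤ) + 3)) - A * frameTW 1 (tTop T) (tList T)) ≤ (p : ℚ) ^ (-(4 : ℤ)) ∧
      padicNorm p (2 * (coeffV b / (-(p : ℚ)) ^ (-(M : ℤ))) - A * frameTV 1 (tTop T) (tList T)) ≤ (p : ℚ) ^ (-(4 : ℤ)) := by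
  have hp0 : 0 < p := hp.out.pos
  have hp2 : p ≠ 2 := by omega
  have hpQ : (p : ℚ) ≠ 0 := Nat.cast_ne_zero.2 hp.out.ne_zero
  have h0 : 0 ≤ b 0 := hb.1.1
  have hpn' : p ≤ (b 0).toNat := by omega
  set L := tTop T with hLdef
  set e := tList T with hedef
  have hpal : ∀ j ≤ L, e (L - j) = e j := tList_pal hT
  -- the per-residue data: `(A_x, C_x)` with `C_x ≡ −2p³·[x live]·ĝκ`
  have hpair : ∀ x ∈ range p, ∃ AC : ℚ × ℚ, padicNorm p AC.1 ≤ (p : ℚ) ^ (-(1 : ℤ)) ∧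
      (¬ (2 ≤ classPoleCount b p x ∧ classExp b p x ≤ -(M : ℤ) + 3) → AC.2 = 0) ∧
      padicNorm p (AC.2 + 2 * (p : ℚ) ^ 3 * (if x ∈ liveSet b p M then liveKappa b p M x else 0)) ≤ (p : ℚ) ^ (-(4 : ℤ)) ∧
      padicNorm p (classW b p x / (-(p : ℚ)) ^ (-(M : ℤ) + 3) + classW b p (conjClass b p x) / (-(p : ℚ)) ^ (-(M : ℤ) + 3)
        - AC.1 * frameTW 1 L e - AC.2 * frameTW 3 L e) ≤ (p : ℚ) ^ (-(4 : ℤ)) ∧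
      padicNorm p (classV b p x / (-(p : ℚ)) ^ (-(M : ℤ)) + classV b p (conjClass b p x) / (-(p : ℚ)) ^ (-(M : ℤ))
        - AC.1 * frameTV 1 L e - AC.2 * frameTV 3 L e) ≤ (p : ℚ) ^ (-(4 : ℤ)) := by
    intro x hxr
    have hx : x < p := mem_range.1 hxr
    have hxn := le_b0_of_lt b hpn hx
    by_cases hlive : 2 ≤ classPoleCount b p x ∧ classExp b p x ≤ -(M : ℤ) + 3
    · obtain ⟨h2, hE3⟩ := hlive
      have hmem : x ∈ multipoleClasses b p := mem_filter.2 ⟨hxr, h2⟩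
      have hEm : -(M : ℤ) ≤ classExp b p x := hC.1 x hmem
      obtain ⟨a, hdom⟩ := live_dominates b hpn hC hS hx h2 hE3
      set i := (classExp b p x + M).toNat with hidef
      have hi : classExp b p x + M = i := by omega
      -- the deep case: `ŵ_x̄ = ŵ_x`
      have hdeepw : i = 0 → wHat b p (conjClass b p x) = wHat b p x := by
        intro hi0
        have hEd : classExp b p x = -(M : ℤ) := by omega
        obtain ⟨hnc, htl⟩ := hC.2.2.1 x hmem hEd
        obtain ⟨hL, hL'⟩ := level_bounds' (p := p) b hxn
        obtain ⟨hxb, hLb, hLb'⟩ := CellKit.conj_level b hx hL hL'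
        have htlb : classTypeList b p (conjClass b p x) = T := by
          rw [ZeroWindows.classTypeList_conj b h0 hx hL hL', htl, hT]
        obtain ⟨-, hlev⟩ := spec_of_typeList (p := p) b hxn htl
        obtain ⟨htopb, hlevb⟩ := spec_of_typeList (p := p) b (le_b0_of_lt b hpn hxb) htlb
        have hncb : ¬ CentreIn b p (conjClass b p x) := by
          intro h
          have := (centreIn_iff_conjClass_eq b hpn' hxb).1 h
          rw [conjClass_conjClass b hx hpn'] at this
          exact hnc ((centreIn_iff_conjClass_eq b hpn' hx).2 this.symm)
        rw [topLevel_conj_level b hx hL hL'] at htopb hlevb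
        rw [wHat_level₀ b hx hL hL' e hlev (fun h => hnc h.2),
          wHat_level₀ b hxb hLb hLb' e (fun k hk => hlevb k hk) (fun h => hncb h.2)]
      obtain ⟨A, C, hA, hCk, hW, hV⟩ := pair₅ b hb hp5 hpn hwin hM hMe hpal hTM hW4 hV4 hx h2 hE3 hEm hdom hi hdeepw
      refine ⟨(A, C), hA, fun h => absurd ⟨h2, hE3⟩ h, ?_, hW, hV⟩
      rw [if_pos (show x ∈ liveSet b p M from mem_filter.2 ⟨hxr, h2, hE3⟩), ← kappaQ_three_sub b p x M i hi (by omega)]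
      simpa [mul_assoc] using hCk
    · -- negligible pair
      have hlivec : ¬ (2 ≤ classPoleCount b p (conjClass b p x) ∧ classExp b p (conjClass b p x) ≤ -(M : ℤ) + 3) := by
        rwa [classPoleCount_conj b h0 hxn, classExp_conj b h0 hxn]
      obtain ⟨hWx, hVx⟩ := negl₄ b hb hp5 hwin hM hC hx hlive
      obtain ⟨hWc, hVc⟩ := negl₄ b hb hp5 hwin hM hC (conjClass_lt b hp0 x) hlivec
      refine ⟨(0, 0), by rw [padicNorm.zero]; exact zpow_p_nonneg _, fun _ => rfl, ?_, ?_, ?_⟩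
      · rw [if_neg (show x ∉ liveSet b p M from fun h => hlive (mem_filter.1 h).2)]; simp [zpow_p_nonneg]
      · simp only [zero_mul, sub_zero]; exact fo_add hWx hWc
      · simp only [zero_mul, sub_zero]; exact fo_add hVx hVc
  choose! AC hAC using hpair
  have hconj : ∀ y ∈ range p, conjClass b p y ∈ range p := fun y _ => mem_range.2 (conjClass_lt b hp0 y)
  -- the τ₃-coefficient `𝒞 = Σ C_x` vanishes to order `p⁴`
  have hCsum : padicNorm p (∑ x ∈ range p, (AC x).2) ≤ (p : ℚ) ^ (-(4 : ℤ)) := by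
    have e1 : ∑ x ∈ range p, (AC x).2 = ∑ x ∈ range p, ((AC x).2 + 2 * (p : ℚ) ^ 3 * (if x ∈ liveSet b p M then liveKappa b p M x else 0))
        - 2 * (p : ℚ) ^ 3 * ∑ x ∈ liveSet b p M, liveKappa b p M x := by
      rw [sum_add_distrib, ← mul_sum, sum_ite_mem, inter_eq_right.mpr (show liveSet b p M ⊆ range p from filter_subset _ _)]
      ring
    rw [e1]
    refine fo_sub (padicNorm.sum_le' (fun x hx => (hAC x hx).2.2.1) (zpow_p_nonneg _)) ?_
    rw [show (-(4 : ℤ)) = -(3 + 1) by norm_num]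
    exact fo_mul (padicNorm_mul_le_right (by rw [padicNorm_two hp2]) (fo_ppow 3)) hres
  -- integrality of the directions (`L < p` when a live class exists; otherwise the live sum of `C` is `0` termwise anyway)
  have ht3 : ∀ {t : ℚ}, (t = frameTW 3 L e ∨ t = frameTV 3 L e) →
      padicNorm p ((∑ x ∈ range p, (AC x).2) * t) ≤ (p : ℚ) ^ (-(4 : ℤ)) := by
    intro t ht
    by_cases hex : ∃ x ∈ range p, 2 ≤ classPoleCount b p x ∧ classExp b p x ≤ -(M : ℤ) + 3
    · obtain ⟨x, hxr, h2, hE3⟩ := hex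
      obtain ⟨a, hdom⟩ := live_dominates b hpn hC hS (mem_range.1 hxr) h2 hE3
      have hLp : L < p := by have := hdom.le; have := topLevel_lt b hb hwin x; omega
      have hn := padicNorm_frameT_le_one hp2 hLp e 3
      rcases ht with rfl | rfl
      · exact padicNorm_mul_le_left hCsum hn.1
      · exact padicNorm_mul_le_left hCsum hn.2
    · -- no live class: every `C_x` may be taken... we only know the bound on the sum; but then each pair is negligible and
      -- `C_x = 0` by construction
      have hz : ∀ x ∈ range p, (AC x).2 = 0 := fun x hx =>
        (hAC x hx).2.1 fun h => hex ⟨x, hx, h⟩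
      rw [sum_eq_zero hz, zero_mul, padicNorm.zero]; exact zpow_p_nonneg _
  refine ⟨∑ x ∈ range p, (AC x).1, padicNorm.sum_le' (fun x hx => (hAC x hx).1) (zpow_p_nonneg _), ?_, ?_⟩
  · have e : 2 * (coeffW b / (-(p : ℚ)) ^ (-(M : ℤ) + 3)) - (∑ x ∈ range p, (AC x).1) * frameTW 1 L e =
        ∑ x ∈ range p, (classW b p x / (-(p : ℚ)) ^ (-(M : ℤ) + 3)
          + classW b p (conjClass b p x) / (-(p : ℚ)) ^ (-(M : ℤ) + 3) - (AC x).1 * frameTW 1 L e - (AC x).2 * frameTW 3 L e)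
          + (∑ x ∈ range p, (AC x).2) * frameTW 3 L e := by
      rw [sum_sub_distrib, sum_sub_distrib, sum_mul, sum_mul, coeffW_eq_sum_classW b hp0, sum_div,
        ← sum_conj_symm b hpn' (range p) (fun y hy => mem_range.1 hy) hconj]
      ring
    rw [e]
    exact fo_add (padicNorm.sum_le' (fun x hx => (hAC x hx).2.2.2.1) (zpow_p_nonneg _)) (ht3 (Or.inl rfl))
  · have e : 2 * (coeffV b / (-(p : ℚ)) ^ (-(M : ℤ))) - (∑ x ∈ range p, (AC x).1) * frameTV 1 L e =
        ∑ x ∈ range p, (classV b p x / (-(p : ℚ)) ^ (-(M : ℤ))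
          + classV b p (conjClass b p x) / (-(p : ℚ)) ^ (-(M : ℤ)) - (AC x).1 * frameTV 1 L e - (AC x).2 * frameTV 3 L e)
          + (∑ x ∈ range p, (AC x).2) * frameTV 3 L e := by
      rw [sum_sub_distrib, sum_sub_distrib, sum_mul, sum_mul, coeffV_eq_sum_classV b hp0, sum_div,
        ← sum_conj_symm b hpn' (range p) (fun y hy => mem_range.1 hy) hconj]
      ring
    rw [e]
    exact fo_add (padicNorm.sum_le' (fun x hx => (hAC x hx).2.2.2.2) (zpow_p_nonneg _)) (ht3 (Or.inr rfl))

end Agg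

end Summit.KontsevichZagierPeriods.Zeta5Search.SecondOrder

end
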